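import Literature.NumberTheory.EllipticCurves.ModularCurveKleinJ
import Literature.NumberTheory.EllipticCurves.HeegnerPoints
import Literature.Barriers.RiemannHypothesis.EpsteinZetaRealZeros
import HarnessLib

/-!
# Schertz 2002, Theorem 3: `√d · γ₃(α)` is a class invariant for odd discriminants

Topic `NumberTheory/EllipticCurves` (singular moduli / complex multiplication; next to
`ComplexMultiplicationSingularModuli`, `GrossZagierSingularModuli`). Statement-level typing (ONE
named fact, no new analytic definitions) of the first display of

> **Theorem 3** (R. Schertz, *Weber's class invariants revisited*, J. Théor. Nombres Bordeaux 14
> (2002) 325–343, pp. 330–331). Let `α ∈ ℍ` be the root of the primitive equation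
> `AX² + BX + C = 0` with `2 ∤ A` of discriminant `D(α) = B² − 4AC = t²d` and we assume
> `B ≡ 0 mod 4` if `2 ∣ D(α)`, `B ≡ 1 mod 4` if `2 ∤ D(α)`. Then
> `ℚ(√d γ₃(α)) = ℚ(j(α))` if `2 ∤ D(α)`, and `ℚ(γ₃(α)) = ℚ(j(2α))` if `2 ∣ D(α)`.
> Herein `ℚ(j(2α))` is conjugate to the maximal real subfield of `Ω_{2t}` which is of degree `2`
> over `ℚ(j(α))` when `2 ∣ D(α)`, `D(α) ≠ −4`. Moreover, in the case `2 ∤ t²d`, if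
> `α = α₁, …, α_{h_t}` is a 2-system mod `t`, the above singular values `γ₃(αᵢ)` form a complete
> set of conjugates over `K`. Thus the minimal equation over `K` is given by `∏ᵢ (X − γ₃(αᵢ))` and
> has coefficients in `𝔒₁`.

with the paper's standing notation (pp. 326–328): `K` an imaginary quadratic field of discriminant
`d`, `𝔒_t` its order of conductor `t`, `Ω_t` the ring class field modulo `t`; "primitive" means
`A, B, C ∈ ℤ`, `gcd(A, B, C) = 1`, `A > 0`; `j` is the modular invariant and
`γ₃(z) = √(j(z) − 12³) := 6³ g₃(z) / ((2π)⁶ η(z)¹²)` (`η` the Dedekind eta function) — so that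
`γ₃(z)² = j(z) − 1728`. (The theorem is Weber's; Schertz's proof uses Shimura reciprocity, §'Proofs',
pp. 338–341. Cox, *Primes of the form x² + ny²*, 2nd ed., p. 263, cites exactly this statement:
"See Schertz [A19, Theorem 3]".)

## What is typed, and why it is the printed statement

Only the FIRST display (the case `2 ∤ D(α)`, i.e. odd discriminants) is recorded, in the
`γ₃`-free but EQUIVALENT form

  `∃ x ∈ ℚ(j(α)), x² = d · (j(α) − 1728)`.

Equivalence: if `ℚ(√d γ₃(α)) = ℚ(j(α))` then `x = √d γ₃(α)` works, since
`(√d γ₃(α))² = d (j(α) − 1728)`; conversely any such `x` equals `± √d γ₃(α)`, so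
`√d γ₃(α) ∈ ℚ(j(α))`, and `j(α) = x²/d + 1728 ∈ ℚ(x)` gives the reverse inclusion — this last step is
the proved lemma `adjoin_simple_eq_of_sq_eq` below, so nothing depends on the sign normalisation of
`γ₃` (which the paper fixes through `g₃/η¹²`). The tree has no `γ₃`; `j` is the tree's `kleinJ`
(`= E₄³/Δ`, file `ModularCurveKleinJ`), `α` is the tree's `heegnerTau (A, B, C)` (the root of
`AX² + BX + C` in `ℍ`, file `HeegnerPoints`), "`d` is the discriminant of an imaginary quadratic
field" is the tree's `IsFundamentalDiscriminant d ∧ d < 0`, and `ℚ(·)` is Mathlib's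
`IntermediateField.adjoin ℚ {·}` inside `ℂ`. The second display (even discriminants), the degree
statement and the conjugates/minimal-equation clause are quoted above but NOT typed (they need the
ring class fields `Ω_t`, absent from the tree). NOT proved here (Shimura reciprocity); users take
`(h : schertz2002_gamma3_classInvariant_odd)`.

Cell context (why it is typed; not part of the statement): for odd `D = t²d` the element
`x = √d γ₃(α) ∈ ℚ(j(α))` has `N_{ℚ(j(α))/ℚ}(x)² = |d|^{h(D)} · H_D(1728)` (norm of `x²`, the
ℚ-conjugates of `j(α)` being the `h(D)` class invariants), which is the printed mechanism behind
square-shape observations on `|D|^h H_D(1728)`; that derivation is the cell's, not Schertz's, and is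
not asserted in this file.

## References

* [Schertz2002] R. Schertz, *Weber's class invariants revisited*, J. Théor. Nombres Bordeaux 14
  (2002) 325–343, doi:10.5802/jtnb.361 — Theorem 3 (pp. 330–331), notation pp. 326–329.
* [Cox2013] D. A. Cox, *Primes of the form x² + ny²*, 2nd ed., §12 (p. 263: γ₃ and the pointer to
  [Schertz2002, Thm 3]; Thm 12.2: the companion statement for γ₂).
-/

noncomputable section

namespace Literature.NumberTheory.EllipticCurves

open Literature.NumberTheory.EllipticCurves.ModularForms
open Literature.Barriers.RiemannHypothesis (IsFundamentalDiscriminant)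
open IntermediateField

/-- **Schertz 2002, Theorem 3, first display (odd discriminants; Weber's class invariant
`√d·γ₃`).** Let `A, B, C ∈ ℤ` with `A > 0`, `gcd(A, B, C) = 1`, `2 ∤ A`, `B ≡ 1 (mod 4)`, and let
`B² − 4AC = t² d` with `t ≥ 1` and `d < 0` the discriminant of an imaginary quadratic field, the
discriminant `B² − 4AC` being ODD; let `α ∈ ℍ` be the root of `AX² + BX + C = 0`. Then
`ℚ(√d γ₃(α)) = ℚ(j(α))` — recorded in the equivalent `γ₃`-free form "some `x ∈ ℚ(j(α))` satisfies
`x² = d (j(α) − 1728)`" (see the module docstring and `adjoin_simple_eq_of_sq_eq`). NOT proved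
here. [cite: Schertz2002, Theorem 3] -/
def schertz2002_gamma3_classInvariant_odd : Prop :=
  ∀ A B C t d : ℤ, 0 < A → Int.gcd (Int.gcd A B) C = 1 → ¬ (2 : ℤ) ∣ A → B % 4 = 1 →
    0 < t → d < 0 → IsFundamentalDiscriminant d → B ^ 2 - 4 * A * C = t ^ 2 * d →
      ¬ (2 : ℤ) ∣ B ^ 2 - 4 * A * C →
        ∃ x ∈ IntermediateField.adjoin ℚ ({kleinJ (heegnerTau (A, B, C))} : Set ℂ),
          x ^ 2 = (d : ℂ) * (kleinJ (heegnerTau (A, B, C)) - 1728)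

/-! ### Proved API -/

/-- The reformulation lemma: if `x² = d (j − 1728)` with `d ≠ 0`, then `ℚ(x) = ℚ(j)` holds iff
`x ∈ ℚ(j)` (the inclusion `ℚ(j) ⊆ ℚ(x)` being automatic from `j = x²/d + 1728`). With
`x = √d γ₃(α)` this shows that the typed form of `schertz2002_gamma3_classInvariant_odd` is
equivalent to the printed `ℚ(√d γ₃(α)) = ℚ(j(α))`. [cite: Schertz2002, Theorem 3 (reformulation)] -/
theorem adjoin_simple_eq_of_sq_eq {x j : ℂ} {d : ℤ} (hd : d ≠ 0)
    (hx : x ^ 2 = (d : ℂ) * (j - 1728)) :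
    IntermediateField.adjoin ℚ ({x} : Set ℂ) = IntermediateField.adjoin ℚ ({j} : Set ℂ) ↔
      x ∈ IntermediateField.adjoin ℚ ({j} : Set ℂ) := by
  constructor
  · intro h
    rw [← h]
    exact mem_adjoin_simple_self ℚ x
  · intro hmem
    apply le_antisymm
    · exact adjoin_simple_le_iff.mpr hmem
    · refine adjoin_simple_le_iff.mpr ?_
      have hd' : (d : ℂ) ≠ 0 := Int.cast_ne_zero.mpr hd
      have hj : j = x ^ 2 / d + 1728 := by
        rw [hx]; field_simp; ring
      rw [hj]
      have hxmem : x ∈ IntermediateField.adjoin ℚ ({x} : Set ℂ) := mem_adjoin_simple_self ℚ x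
      refine add_mem (div_mem (pow_mem hxmem 2) ?_) ?_
      · exact_mod_cast IntermediateField.intCast_mem (IntermediateField.adjoin ℚ ({x} : Set ℂ)) d
      · exact_mod_cast IntermediateField.natCast_mem (IntermediateField.adjoin ℚ ({x} : Set ℂ)) 1728

/-- Sanity instance at `D = −7` (`A, B, C = 1, 1, 2`: `2 ∤ A`, `B ≡ 1 (4)`, `D = −7 = 1²·(−7)` odd):
granted the classical value `j((−1+√−7)/2) = −3375 = −15³` (the `d = −7` row of the tree's table
`singularModuli_classNumberOne`, cf. `GrossZagier1985.kleinJ_formTau_neg_seven`), the conclusion of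
Theorem 3 holds with the RATIONAL witness `x = 189`: `(−7)·(−3375 − 1728) = 35721 = 189²`, i.e.
`√(−7)·γ₃(α) = ±189 ∈ ℚ = ℚ(j(α))` (class number one). [cite: Schertz2002, Theorem 3 (instance D = −7)] -/
theorem schertz2002_gamma3_classInvariant_odd_neg_seven
    (hj : kleinJ (heegnerTau (1, 1, 2)) = -3375) :
    ∃ x ∈ IntermediateField.adjoin ℚ ({kleinJ (heegnerTau (1, 1, 2))} : Set ℂ),
      x ^ 2 = ((-7 : ℤ) : ℂ) * (kleinJ (heegnerTau (1, 1, 2)) - 1728) := by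
  refine ⟨189, ?_, ?_⟩
  · exact_mod_cast
      IntermediateField.natCast_mem (IntermediateField.adjoin ℚ ({kleinJ (heegnerTau (1, 1, 2))} : Set ℂ)) 189
  · rw [hj]; norm_num

/-- The hypotheses of Theorem 3 at `(A, B, C) = (1, 1, 2)`: primitive, `2 ∤ A`, `B ≡ 1 (mod 4)`,
`B² − 4AC = −7 = 1² · (−7)` odd, `−7` a negative fundamental discriminant.
[cite: Schertz2002, Theorem 3 (hypotheses at D = −7)] -/
theorem schertz2002_hypotheses_neg_seven :
    (0 : ℤ) < 1 ∧ Int.gcd (Int.gcd 1 1) 2 = 1 ∧ ¬ (2 : ℤ) ∣ 1 ∧ (1 : ℤ) % 4 = 1 ∧ (0 : ℤ) < 1 ∧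
      (-7 : ℤ) < 0 ∧ IsFundamentalDiscriminant (-7) ∧ (1 : ℤ) ^ 2 - 4 * 1 * 2 = 1 ^ 2 * (-7) ∧
      ¬ (2 : ℤ) ∣ (1 : ℤ) ^ 2 - 4 * 1 * 2 := by
  refine ⟨by norm_num, by decide, by decide, by decide, by norm_num, by norm_num, ?_, by norm_num,
    by decide⟩
  unfold IsFundamentalDiscriminant
  exact Or.inl ⟨by decide, Int.squarefree_natAbs.mp
    (by rw [show (-7 : ℤ).natAbs = 7 from rfl]; exact Nat.prime_seven.squarefree), by decide⟩

/-- Consequently, under the fact and independently of it via the table value `j = −3375`, the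
`D = −7` instance of Theorem 3 reads `∃ x ∈ ℚ(j(α)), x² = −7·(j(α) − 1728)`; here it is derived
from the named fact (a consistency check of the typing: the hypotheses are satisfiable as typed).
[cite: Schertz2002, Theorem 3 (instance D = −7)] -/
theorem schertz2002_gamma3_classInvariant_odd.neg_seven
    (h : schertz2002_gamma3_classInvariant_odd) :
    ∃ x ∈ IntermediateField.adjoin ℚ ({kleinJ (heegnerTau (1, 1, 2))} : Set ℂ),
      x ^ 2 = ((-7 : ℤ) : ℂ) * (kleinJ (heegnerTau (1, 1, 2)) - 1728) := by
  obtain ⟨h1, h2, h3, h4, h5, h6, h7, h8, h9⟩ := schertz2002_hypotheses_neg_seven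
  exact h 1 1 2 1 (-7) h1 h2 h3 h4 h5 h6 h7 h8 h9

end Literature.NumberTheory.EllipticCurves
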